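import Literature.MathematicalPhysics.QuantumFieldTheory.Balaban1983to89.B1Eq324BenfattoKernelSect5LowerAssemblyStop
import Literature.MathematicalPhysics.QuantumFieldTheory.Balaban1983to89.B1Eq324BenfattoKernelSect5LedgerBridge
import Literature.MathematicalPhysics.QuantumFieldTheory.Balaban1983to89.B1Eq324BenfattoKernelSect5ChainGeometry
import HarnessLib

/-!
# `Balaban1983to89.B1Eq324BenfattoKernelSect5Ineq47Class` — (4.7) FOR EVERY MEMBER OF THE CLASS, nI-FORM, from the LOWER LEDGER PACK
([BenfattoEtAl1978] Basic Lemma (4.7) p. 152 «P̂₀(Π_Δχ̂ᵇ_Δ e^{H_I}) ≥ exp(Σ ε^T/n! − |I|·ε(A,b,t))» over the class of [Balaban1985BackgroundPropagators] Sect. E)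

WHY THIS MODULE (cell `pub-ymgap`, seat `dag-n08-b` gen 13; node N08 [Balaban1985UV3]; seat n08-c's word W1 for the `∃`-knit of the class Basic
Lemma, `…KernelSect5ClassBasicLemma`).  Everything upstream is by name: the class (4.7) knit at the stopping index
(`…KernelSect5LowerAssemblyStop.exp_cumulantSum_sub_le_integral_of_ledger_stop`), the nI-form socket (`…KernelSect5LedgerBridge.ledger_geometric_le_nI`),
the stopping index (seat n08-d's `…KernelSect5PavementChain.exists_stoppingIndex`), the chain geometry (seat n08-c's `…KernelSect5ChainGeometry`:
pavements and corridors inside the frames from the padding of `J` in `Λ`, the separation of the constant diagonal displacements), the chain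
invariants and the clipped coefficient (print's `…Sect5PavementChain`).  This file does the PER-MEMBER QUANTIFIER-FREE ASSEMBLY: for ONE class member
`(Λ, A, K)`, ONE `b` with the pavement side of `…KernelSect5LedgerDischargeLower.lowerpack_class'` at `b` (`L, w, v` and its eleven side conditions),
data `J ⊆ I ≠ ∅`, `a` (bound `A_c = coefSup`), the padding `∀ x ∈ J, ∀ z, (∀ i, |z_i − x_i| < L) → z ∈ Λ`, and the pack's nI-form ledger clause at
`nI := |I|` for every stopping index `n ≤ d + 1`:
`exp(cumulantSum μ_K H^a_J t − |I|·errTerm S ρ₁ ρ₂ ρ₃ ρ₄ A_c b t) ≤ ∫Π_Δχ̂^I_b e^{H^a_J} dμ_K`.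
The chain is print's: constant diagonal displacements `τ_k ≡ −2(2w+v)·𝟙`, `J_{k+1} = (J_k+τ_k) ∩ Γ̄₁(B_k)`, `I_{k+1} = I_k+τ_k`, `A_{k+1} = (A_k(·−τ_k))|_{Γ̄₁(B_k)}`,
`b_k = γ^k b`, kernel offsets `σ_{k+1} = σ_k − τ_k`, boxes `B_k = (J_k+τ_k).image boxIndex`, part kernels `K^{(k)}_□` DEFINED by the knit's formula, letters
`K_u(k) = (1 + VM/(γ_A−J_c))γb_k`, `K₀(k) = max(max 1 (1/(γ_A−J_c)), K_u(k))`, `ε₃₁(k) = ε₁ + ε₂(b_k)`.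

WHAT IS PROVED (one theorem, no definition, no named fact, no `sorry`; axioms standard): ★★★ `ineq47_class_of_pack` — binders = [member rows of the knit +
`J_c, V, M, V₂, M₂, V₄ ≥ 0`, `1/γ_A ≤ 1/2`] [scheme `ϰ > 0`, `0 < γ ≤ 1`, `VMγ/(γ_A−J_c) ≤ 1/2`, rate `0 < δ ≤ θ/√d`, `δD²√d < ϰ`, `t`] [pavement at `b`:
`lowerpack_class'`'s conjuncts] [data `J ⊆ I ≠ ∅`, `a`, `A_c = coefSup s D a J`, padding] [ledger: the pack's clause at `nI := |I|`, `A := A_c`, all `n ≤ d+1`].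

HONEST SCOPE / NOT HERE.  Quantifier-free assembly of landed theorems of this cell (no new estimate, no measure-theoretic step beyond the knit's); the
`∃`-bookkeeping over `b*`, `S`, `ρ`'s and the class is seat n08-c's `…KernelSect5ClassBasicLemma`; the (4.6) twin is `…KernelSect5Ineq46Class`.
Count-neutral Literature helper of the class road (our class form of [BenfattoEtAl1978] §5; the port is NOT commissioned); nothing of
[Balaban1985UV3]/[Balaban1984UV2] is asserted; node N08 is NOT discharged; no summit statement is proved; the Yang–Mills mass gap (Clay) is NOT
proved by any of this.
-/

noncomputable section

open MeasureTheory ProbabilityTheory Finset Matrix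
open scoped BigOperators Nat NNReal

namespace Literature.MathematicalPhysics.QuantumFieldTheory.Balaban1983to89.B1Eq324BenfattoKernelSect5Ineq47Class

open _root_.MeasureTheory _root_.ProbabilityTheory
open Literature.Probability.LatticeModels (setPartitions)
open Literature.MathematicalPhysics.QuantumFieldTheory
open Literature.MathematicalPhysics.QuantumFieldTheory.Balaban1983to89.B1Eq324BenfattoLemma
open Literature.MathematicalPhysics.QuantumFieldTheory.Balaban1983to89.B1Eq324BenfattoSect5Boxes
open Literature.MathematicalPhysics.QuantumFieldTheory.Balaban1983to89.B1Eq324BenfattoSect5Eq511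
open Literature.MathematicalPhysics.QuantumFieldTheory.Balaban1983to89.B1Eq324BenfattoSect5Eq524
open Literature.MathematicalPhysics.QuantumFieldTheory.Balaban1983to89.B1Eq324BenfattoSect5Eq534
open Literature.MathematicalPhysics.QuantumFieldTheory.Balaban1983to89.B1Eq324BenfattoSect5Eq515
open Literature.MathematicalPhysics.QuantumFieldTheory.Balaban1983to89.B1Eq324BenfattoSect5Iteration (restrictCoef shiftCoef)
open Literature.MathematicalPhysics.QuantumFieldTheory.Balaban1983to89.B1Eq324BenfattoSpecialisation (coefSup_nonneg)
open Literature.MathematicalPhysics.QuantumFieldTheory.Balaban1983to89.B1Eq324BenfattoKernelSect5Iteration (mem_image_sub_iff)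
open Literature.MathematicalPhysics.QuantumFieldTheory.Balaban1983to89.B1Eq324BenfattoSect5PavementChain
  (chain_invariants exists_coefSupportedIn_clip)
open Literature.MathematicalPhysics.QuantumFieldTheory.Balaban1983to89.B1Eq324BenfattoSect5CollectErrors (card_chain_le)
open Literature.MathematicalPhysics.QuantumFieldTheory.Balaban1983to89.B1Eq324BenfattoKernelSect5PavementChain (exists_stoppingIndex)
open Literature.MathematicalPhysics.QuantumFieldTheory.Balaban1983to89.B1Eq324BenfattoKernelSect5ChainGeometry
  (boxes_subset_frame_of_pad corridors_subset_frame_of_pad sep_of_constDiagonal)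
open Literature.MathematicalPhysics.QuantumFieldTheory.Balaban1983to89.B1Eq324BenfattoKernelSect5LowerAssemblyStop
  (exp_cumulantSum_sub_le_integral_of_ledger_stop)
open Literature.MathematicalPhysics.QuantumFieldTheory.Balaban1983to89.B1Eq324BenfattoKernelSect5LedgerBridge (ledger_geometric_le_nI)
open Literature.MathematicalPhysics.QuantumFieldTheory.Balaban1983to89.B1Eq324BenfattoKernelSect5LedgerDischargeLower (K0_ties)
open Literature.MathematicalPhysics.QuantumFieldTheory.Balaban1983to89.B1Eq324GaussianMomentLeaf (momentConst)

variable {d : ℕ}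

section Member

variable {Λ : Finset (B1Eq324BenfattoLemma.Site d)} {A : Matrix Λ Λ ℝ}
  {K : B1Eq324BenfattoLemma.Site d → B1Eq324BenfattoLemma.Site d → ℝ}
  (hK : ∀ x y, K x y = if h : x ∈ Λ ∧ y ∈ Λ then (A⁻¹ : Matrix Λ Λ ℝ) ⟨x, h.1⟩ ⟨y, h.2⟩ else 0)

include hK

set_option maxHeartbeats 1600000 in
/-- ★★★ **(4.7) FOR EVERY MEMBER OF THE CLASS, nI-FORM** — for a class member `(Λ, A, K)` (`Λ ≠ ∅`; `A` symmetric `γ_A`-coercive; Euclidean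
Combes–Thomas row `J_c < γ_A` at rate `θ`; rows `V, M, V₂, M₂, V₄`; `1/γ_A ≤ 1/2`), a scheme `ϰ > 0`, `0 < γ ≤ 1` with `VMγ/(γ_A−J_c) ≤ 1/2`, a rate
`0 < δ ≤ θ/√d` with `δD²√d < ϰ`, the pavement side of `lowerpack_class'` at `b` (`2(2w+v) < L`, `(d+1)·2(2w+v) ≤ L`, `v ≤ w`, `1 ≤ w`, `1 ≤ γ^{d+1}b`,
`L^d e^{−(γ^d b)²/4} ≤ 1/6`, guard, width rows, terminal rows), data `J ⊆ I ≠ ∅`, `a` with `A_c = coefSup s D a J`, the padding of `J` in `Λ` at sup-radius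
`L`, and the nI-form lower ledger at `nI := |I|`, `A := A_c` for every `n ≤ d + 1`:
`exp(cumulantSum μ_K H^a_J t − |I|·errTerm S ρ₁ ρ₂ ρ₃ ρ₄ A_c b t) ≤ ∫Π_Δχ̂^I_b e^{H^a_J} dμ_K`.  Proof: clip `a` to `J`; print's chain by `Nat.rec`; the
stopping index `m ≤ d+1` (`exists_stoppingIndex` + `sep_of_constDiagonal`); frames by `boxes/corridors_subset_frame_of_pad`; part kernels and letters by
definition (`K0_ties`); `ledger_geometric_le_nI` at `E := |I|·errTerm …` fed with the clause at `n := m`; `exp_cumulantSum_sub_le_integral_of_ledger_stop`.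
[cite: BenfattoEtAl1978, Basic Lemma (4.7) p.152; §5 pp.154–159 «After (d + 1) steps», «Collecting all the errors»; Appendix A p.161;
Balaban1985BackgroundPropagators, (1.16)–(1.18) p.180, Sect. E p.428 (class form; ours)] -/
theorem ineq47_class_of_pack (hΛ : Λ.Nonempty)
    (hAs : ∀ e e', A e e' = A e' e) {γA : ℝ} (hγA0 : 0 < γA)
    (hγA : ∀ x : Λ → ℝ, γA * ∑ e, x e ^ 2 ≤ ∑ e, ∑ e', A e e' * x e * x e')
    {θ Jc V M V₂ M₂ V₄ : ℝ} (hθ : 0 < θ)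
    (hJc : ∀ e : Λ, ∑ e' : Λ, |A e e'| * (Real.cosh (θ * Real.sqrt (∑ j, ((((e : B1Eq324BenfattoLemma.Site d) j : ℝ) - ((e' : B1Eq324BenfattoLemma.Site d) j : ℝ))) ^ 2)) - 1) ≤ Jc)
    (hJcγ : Jc < γA)
    (hV : ∀ e : Λ, ∑ e' : Λ, Real.exp (-(θ * Real.sqrt (∑ j, ((((e : B1Eq324BenfattoLemma.Site d) j : ℝ) - ((e' : B1Eq324BenfattoLemma.Site d) j : ℝ))) ^ 2))) *
      (1 + Real.sqrt (∑ j, ((((e : B1Eq324BenfattoLemma.Site d) j : ℝ) - ((e' : B1Eq324BenfattoLemma.Site d) j : ℝ))) ^ 2)) ≤ V)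
    (hM : ∀ e : Λ, ∑ e' : Λ, |A e e'| * (1 + Real.sqrt (∑ j, ((((e : B1Eq324BenfattoLemma.Site d) j : ℝ) - ((e' : B1Eq324BenfattoLemma.Site d) j : ℝ))) ^ 2)) ≤ M)
    (hV₂ : ∀ e : Λ, ∑ e' : Λ, Real.exp (-(θ / 2 * Real.sqrt (∑ j, ((((e : B1Eq324BenfattoLemma.Site d) j : ℝ) - ((e' : B1Eq324BenfattoLemma.Site d) j : ℝ))) ^ 2))) ≤ V₂)
    (hM₂ : ∀ e : Λ, ∑ e' : Λ, |A e e'| * Real.exp (θ / 2 * Real.sqrt (∑ j, ((((e : B1Eq324BenfattoLemma.Site d) j : ℝ) - ((e' : B1Eq324BenfattoLemma.Site d) j : ℝ))) ^ 2)) ≤ M₂)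
    (hV₄ : ∀ e : Λ, ∑ e' : Λ, Real.exp (-(θ / 4 * Real.sqrt (∑ j, ((((e : B1Eq324BenfattoLemma.Site d) j : ℝ) - ((e' : B1Eq324BenfattoLemma.Site d) j : ℝ))) ^ 2))) *
      (1 + Real.sqrt (∑ j, ((((e : B1Eq324BenfattoLemma.Site d) j : ℝ) - ((e' : B1Eq324BenfattoLemma.Site d) j : ℝ))) ^ 2)) ≤ V₄)
    (hJc0 : 0 ≤ Jc) (hV0 : 0 ≤ V) (hM0 : 0 ≤ M) (hV₂0 : 0 ≤ V₂) (hM₂0 : 0 ≤ M₂) (hV₄0 : 0 ≤ V₄) (hhalf : 1 / γA ≤ 1 / 2)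
    {κ : ℝ} (hκ : 0 < κ) {γ : ℝ} (hγ0 : 0 < γ) (hγ1 : γ ≤ 1) (hsmallγ : V * M / (γA - Jc) * γ ≤ 1 / 2)
    {D : ℕ} {δ : ℝ} (hδ : 0 < δ) (hδle : δ ≤ θ / Real.sqrt d) (hres : 0 < κ / 2 - δ / 2 * ((D : ℝ) ^ 2 * Real.sqrt d)) (t : ℕ)
    {b : ℝ} {L w v : ℕ} (hL2 : 2 * (2 * w + v) < L) (hfit : (d + 1) * (2 * (2 * w + v)) ≤ L) (hv : v ≤ w) (hw : 1 ≤ w)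
    (hgb1 : 1 ≤ γ ^ (d + 1) * b) (hsmall : ((L : ℝ) ^ d) * Real.exp (-((γ ^ d * b) ^ 2 / 4)) ≤ 1 / 6)
    (hguard : Jc / (Real.cosh (θ * w) - 1) < γA) (hW1 : 1 ≤ θ * w) (hW2 : 4 * Jc / γA ≤ (θ * w) ^ 2)
    (hterm : ∀ n : ℕ, n ≤ d + 1 → 4 * (1 / γA) ≤ (γ ^ n * b) ^ 2)
    {s : ℕ} {I J : Finset (B1Eq324BenfattoLemma.Site d)} (hJI : J ⊆ I) (hI : I.Nonempty) (a : Coef d) {Ac : ℝ} (hAdef : Ac = coefSup s D a J)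
    (hpad : ∀ x ∈ J, ∀ z : B1Eq324BenfattoLemma.Site d, (∀ i, |z i - x i| < (L : ℤ)) → z ∈ Λ)
    {S ρ₁ ρ₂ ρ₃ ρ₄ : ℝ}
    (hledger : ∀ n : ℕ, n ≤ d + 1 →
          ∑ j ∈ Finset.range n,
              ((s1Const s D d κ * Ac * (γ ^ j * b) ^ D * Real.exp (-(κ / 4 * w)) * (I.card : ℝ)
                + s1Const s D d κ * Ac * (γ ^ j * b) ^ D *
                  (Real.exp (-(κ / 4 * w)) * ((I.card : ℝ) * (L : ℝ) ^ d) +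
                    Real.exp (-(κ / 4 * v)) * ((I.card : ℝ) * (L : ℝ) ^ d))
                + (32 * (Jc / γA) * (2 / (1 - Real.exp (-(θ / 2 / Real.sqrt d))) * Real.exp (θ / 2 / Real.sqrt d)) ^ d +
                    8 * Jc * ((1 + V * M / (γA - Jc) * γ) ^ 2) * (γ ^ j * b) ^ 2 *
                      ((2 * (1 + Real.sqrt d * ((L : ℝ) - 1)) ^ 2 + 128 / θ ^ 2) *
                        (2 / (1 - Real.exp (-(θ / 4 / Real.sqrt d))) * Real.exp (θ / 4 / Real.sqrt d)) ^ d)) *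
                  ((I.card : ℝ) * (L : ℝ) ^ d) * Real.exp (-(θ * w / 2)))
                + ((I.card : ℝ) *
                    (2 * (2 ^ ((t + 1).choose 2) * (4 * (s1Const s D d κ * Ac * (γ ^ j * b) ^ D * (L : ℝ) ^ d)) ^ (t + 1) / (t + 1)!) +
                          Real.exp (2 * (4 * (s1Const s D d κ * Ac * (γ ^ j * b) ^ D * (L : ℝ) ^ d))) *
                            (3 * ((L : ℝ) ^ d * Real.exp (-((γ ^ j * b) ^ 2 / 4)))) +
                          ∑ k ∈ Finset.range t,
                            (3 ^ (k + 1) * ((∑ π ∈ setPartitions (univ : Finset (Fin (k + 1))), ((π.card - 1)! : ℝ)) *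
                                (s1Const s D d κ * Ac * (γ ^ j * b) ^ D * Real.exp (-(κ / 4 * v)) * (L : ℝ) ^ d *
                                  (4 * (s1Const s D d κ * Ac * (γ ^ j * b) ^ D * (L : ℝ) ^ d)) ^ k)) +
                              3 ^ (k + 1) * (2 ^ (k + 1) * ((∑ π ∈ setPartitions (univ : Finset (Fin (k + 1))), ((π.card - 1)! : ℝ)) *
                                  ((min 1 (2 * (L : ℝ) ^ d * Real.exp (-((γ ^ j * b) ^ 2 / 4)))) ^ ((2 * (k + 1) : ℕ) : ℝ)⁻¹ *
                                    ((1 + ((1 + V * M / (γA - Jc)) * (γ * (γ ^ j * b)))) ^ D * (Ac * (L : ℝ) ^ d * ∑ p ∈ Finset.Icc 1 s, ((admissible p D).card : ℝ) *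
                    ((2 / (1 - Real.exp (-(κ / 2 / (p : ℕ) / Real.sqrt d))) * Real.exp (κ / 2 / (p : ℕ) / Real.sqrt d)) ^ d) ^ (p - 1)) * momentConst D (2 * (k + 1)) (max (max 1 (1 / (γA - Jc))) ((1 + V * M / (γA - Jc)) * (γ * (γ ^ j * b)))).toNNReal) ^ (k + 1))) +
                                2 ^ ((k + 1) * D) * 2 ^ 2 ^ ((k + 1) * D) * (max (max 1 (1 / (γA - Jc))) ((1 + V * M / (γA - Jc)) * (γ * (γ ^ j * b)))) ^ ((k + 1) * D) * Real.exp (-(δ / 2 * ((v : ℝ) + 1))) *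
                                  (Ac * Real.exp (δ / 2 * ((D : ℝ) ^ 2 * d)) * (L : ℝ) ^ d * ∑ p ∈ Finset.Icc 1 s, ((admissible p D).card : ℝ) *
                    ((2 / (1 - Real.exp (-((κ / 2 - δ / 2 * ((D : ℝ) ^ 2 * Real.sqrt d)) / (p : ℕ) / Real.sqrt d))) *
                      Real.exp ((κ / 2 - δ / 2 * ((D : ℝ) ^ 2 * Real.sqrt d)) / (p : ℕ) / Real.sqrt d)) ^ d) ^ (p - 1)) ^ (k + 1)) +
                              3 ^ (k + 1) * (2 ^ (k + 1) * ((∑ π ∈ setPartitions (univ : Finset (Fin (k + 1))), ((π.card - 1)! : ℝ)) *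
                                  ((min 1 (2 * (L : ℝ) ^ d * Real.exp (-((γ ^ j * b) ^ 2 / 4)))) ^ ((2 * (k + 1) : ℕ) : ℝ)⁻¹ *
                                    ((1 + ((1 + V * M / (γA - Jc)) * (γ * (γ ^ j * b)))) ^ D * (Ac * (L : ℝ) ^ d * ∑ p ∈ Finset.Icc 1 s, ((admissible p D).card : ℝ) *
                    ((2 / (1 - Real.exp (-(κ / 2 / (p : ℕ) / Real.sqrt d))) * Real.exp (κ / 2 / (p : ℕ) / Real.sqrt d)) ^ d) ^ (p - 1)) * momentConst D (2 * (k + 1)) (max (max 1 (1 / (γA - Jc))) ((1 + V * M / (γA - Jc)) * (γ * (γ ^ j * b)))).toNNReal) ^ (k + 1))) +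
                                (Ac * (L : ℝ) ^ d * ∑ p ∈ Finset.Icc 1 s, ((admissible p D).card : ℝ) *
                    ((2 / (1 - Real.exp (-(κ / 2 / (p : ℕ) / Real.sqrt d))) * Real.exp (κ / 2 / (p : ℕ) / Real.sqrt d)) ^ d) ^ (p - 1)) ^ (k + 1) * (2 ^ ((k + 1) * D) * 2 ^ 2 ^ ((k + 1) * D) *
                                  ((((k + 1) * D : ℕ) : ℝ) * (max (max 1 (1 / (γA - Jc))) ((1 + V * M / (γA - Jc)) * (γ * (γ ^ j * b)))) ^ ((k + 1) * D) * ((V₂ * M₂ / (γA - Jc) ^ 2 * Real.exp (-(θ / 2 * ((w - v : ℕ) : ℝ))) + Real.exp (-(θ * ((w - v : ℕ) : ℝ))) / (γA - Jc)) + M₂ / (γA - Jc) * (γ * (γ ^ j * b)) * (1 + Real.sqrt d * ((L : ℝ) - 1)) * V₄ * Real.exp (-(θ / 4 * ((w - v : ℕ) : ℝ)))))))) / (k + 1)!) +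
                  ∑ k ∈ Finset.range t,
                ((2 ^ (k + 1) * (2 ^ ((k + 1) * D) * 2 ^ 2 ^ ((k + 1) * D) * (max (max 1 (1 / (γA - Jc))) ((1 + V * M / (γA - Jc)) * (γ * (γ ^ j * b)))) ^ ((k + 1) * D)) *
                ((Ac * Real.exp (δ / 2 * ((D : ℝ) ^ 2 * d)) *
                    Real.exp (-((κ / 2 - δ / 2 * ((D : ℝ) ^ 2 * Real.sqrt d)) / 2 * w))) * (I.card : ℝ) *
                  ∑ p ∈ Finset.Icc 1 s, ((admissible p D).card : ℝ) *
                    ((2 / (1 - Real.exp (-((κ / 2 - δ / 2 * ((D : ℝ) ^ 2 * Real.sqrt d)) / 2 / (p : ℕ) / Real.sqrt d))) *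
                      Real.exp ((κ / 2 - δ / 2 * ((D : ℝ) ^ 2 * Real.sqrt d)) / 2 / (p : ℕ) / Real.sqrt d)) ^ d) ^ (p - 1)) *
                (Ac * Real.exp (δ / 2 * ((D : ℝ) ^ 2 * d)) *
                  ((1 : ℝ) * (2 / (1 - Real.exp (-(δ / (2 * ((k + 1 : ℕ) : ℝ)) / Real.sqrt d))) * Real.exp (δ / (2 * ((k + 1 : ℕ) : ℝ)) / Real.sqrt d)) ^ d) *
                  ∑ p ∈ Finset.Icc 1 s, ((admissible p D).card : ℝ) *
                    ((2 / (1 - Real.exp (-((κ / 2 - δ / 2 * ((D : ℝ) ^ 2 * Real.sqrt d)) / (p : ℕ) / Real.sqrt d))) *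
                      Real.exp ((κ / 2 - δ / 2 * ((D : ℝ) ^ 2 * Real.sqrt d)) / (p : ℕ) / Real.sqrt d)) ^ d) ^ (p - 1)) ^ k
                + 2 ^ (k + 1) * (2 ^ ((k + 1) * D) * 2 ^ 2 ^ ((k + 1) * D) * (max (max 1 (1 / (γA - Jc))) ((1 + V * M / (γA - Jc)) * (γ * (γ ^ j * b)))) ^ ((k + 1) * D)) *
              ((I.card : ℝ) * (Ac * Real.exp (δ / 2 * ((D : ℝ) ^ 2 * d)) * Real.exp (-((κ / 2 - δ / 2 * ((D : ℝ) ^ 2 * Real.sqrt d)) / 2 * v)) *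
                (L : ℝ) ^ d * ∑ p ∈ Finset.Icc 1 s, ((admissible p D).card : ℝ) *
                    ((2 / (1 - Real.exp (-((κ / 2 - δ / 2 * ((D : ℝ) ^ 2 * Real.sqrt d)) / 2 / (p : ℕ) / Real.sqrt d))) *
                      Real.exp ((κ / 2 - δ / 2 * ((D : ℝ) ^ 2 * Real.sqrt d)) / 2 / (p : ℕ) / Real.sqrt d)) ^ d) ^ (p - 1))) *
              (Ac * Real.exp (δ / 2 * ((D : ℝ) ^ 2 * d)) *
                (2 / (1 - Real.exp (-(δ / (2 * ((k + 1 : ℕ) : ℝ)) / Real.sqrt d))) * Real.exp (δ / (2 * ((k + 1 : ℕ) : ℝ)) / Real.sqrt d)) ^ d *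
                ∑ p ∈ Finset.Icc 1 s, ((admissible p D).card : ℝ) *
                    ((2 / (1 - Real.exp (-((κ / 2 - δ / 2 * ((D : ℝ) ^ 2 * Real.sqrt d)) / (p : ℕ) / Real.sqrt d))) *
                      Real.exp ((κ / 2 - δ / 2 * ((D : ℝ) ^ 2 * Real.sqrt d)) / (p : ℕ) / Real.sqrt d)) ^ d) ^ (p - 1)) ^ k)
                + (2 ^ (k + 1) * (2 ^ ((k + 1) * D) * 2 ^ 2 ^ ((k + 1) * D) * (max (max 1 (1 / (γA - Jc))) ((1 + V * M / (γA - Jc)) * (γ * (γ ^ j * b)))) ^ ((k + 1) * D)) *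
                (Ac * Real.exp (δ / 2 * ((D : ℝ) ^ 2 * d)) * Real.exp (-((κ / 2 - δ / 2 * ((D : ℝ) ^ 2 * Real.sqrt d)) / 2 * w)) *
                  ((I.card : ℝ) * (L : ℝ) ^ d) * ∑ p ∈ Finset.Icc 1 s, ((admissible p D).card : ℝ) *
                    ((2 / (1 - Real.exp (-((κ / 2 - δ / 2 * ((D : ℝ) ^ 2 * Real.sqrt d)) / 2 / (p : ℕ) / Real.sqrt d))) *
                      Real.exp ((κ / 2 - δ / 2 * ((D : ℝ) ^ 2 * Real.sqrt d)) / 2 / (p : ℕ) / Real.sqrt d)) ^ d) ^ (p - 1)) *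
                (Ac * Real.exp (δ / 2 * ((D : ℝ) ^ 2 * d)) *
                  (2 / (1 - Real.exp (-(δ / (2 * ((k + 1 : ℕ) : ℝ)) / Real.sqrt d))) * Real.exp (δ / (2 * ((k + 1 : ℕ) : ℝ)) / Real.sqrt d)) ^ d *
                  ∑ p ∈ Finset.Icc 1 s, ((admissible p D).card : ℝ) *
                    ((2 / (1 - Real.exp (-((κ / 2 - δ / 2 * ((D : ℝ) ^ 2 * Real.sqrt d)) / (p : ℕ) / Real.sqrt d))) *
                      Real.exp ((κ / 2 - δ / 2 * ((D : ℝ) ^ 2 * Real.sqrt d)) / (p : ℕ) / Real.sqrt d)) ^ d) ^ (p - 1)) ^ k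
                + 2 ^ (k + 1) * (2 ^ ((k + 1) * D) * 2 ^ 2 ^ ((k + 1) * D) * (max (max 1 (1 / (γA - Jc))) ((1 + V * M / (γA - Jc)) * (γ * (γ ^ j * b)))) ^ ((k + 1) * D)) *
              ((I.card : ℝ) * (Ac * Real.exp (δ / 2 * ((D : ℝ) ^ 2 * d)) * Real.exp (-((κ / 2 - δ / 2 * ((D : ℝ) ^ 2 * Real.sqrt d)) / 2 * v)) *
                (L : ℝ) ^ d * ∑ p ∈ Finset.Icc 1 s, ((admissible p D).card : ℝ) *
                    ((2 / (1 - Real.exp (-((κ / 2 - δ / 2 * ((D : ℝ) ^ 2 * Real.sqrt d)) / 2 / (p : ℕ) / Real.sqrt d))) *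
                      Real.exp ((κ / 2 - δ / 2 * ((D : ℝ) ^ 2 * Real.sqrt d)) / 2 / (p : ℕ) / Real.sqrt d)) ^ d) ^ (p - 1))) *
              (Ac * Real.exp (δ / 2 * ((D : ℝ) ^ 2 * d)) *
                (2 / (1 - Real.exp (-(δ / (2 * ((k + 1 : ℕ) : ℝ)) / Real.sqrt d))) * Real.exp (δ / (2 * ((k + 1 : ℕ) : ℝ)) / Real.sqrt d)) ^ d *
                ∑ p ∈ Finset.Icc 1 s, ((admissible p D).card : ℝ) *
                    ((2 / (1 - Real.exp (-((κ / 2 - δ / 2 * ((D : ℝ) ^ 2 * Real.sqrt d)) / (p : ℕ) / Real.sqrt d))) *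
                      Real.exp ((κ / 2 - δ / 2 * ((D : ℝ) ^ 2 * Real.sqrt d)) / (p : ℕ) / Real.sqrt d)) ^ d) ^ (p - 1)) ^ k)
                + 2 ^ ((k + 1) * D) * 2 ^ 2 ^ ((k + 1) * D) * (max (max 1 (1 / (γA - Jc))) ((1 + V * M / (γA - Jc)) * (γ * (γ ^ j * b)))) ^ ((k + 1) * D) *
              ((I.card : ℝ) * (((k + 1 : ℕ) : ℝ) * (k : ℝ) *
                ((Ac * Real.exp (δ / 2 * ((D : ℝ) ^ 2 * d)) * ((L : ℝ) ^ d * (2 / (1 - Real.exp (-(δ / (2 * ((k + 1 : ℕ) : ℝ)) / Real.sqrt d))) * Real.exp (δ / (2 * ((k + 1 : ℕ) : ℝ)) / Real.sqrt d)) ^ d) *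
                    ∑ p ∈ Finset.Icc 1 s, ((admissible p D).card : ℝ) *
                    ((2 / (1 - Real.exp (-((κ / 2 - δ / 2 * ((D : ℝ) ^ 2 * Real.sqrt d)) / (p : ℕ) / Real.sqrt d))) *
                      Real.exp ((κ / 2 - δ / 2 * ((D : ℝ) ^ 2 * Real.sqrt d)) / (p : ℕ) / Real.sqrt d)) ^ d) ^ (p - 1)) * ((Ac * Real.exp (δ / 2 * ((D : ℝ) ^ 2 * d)) * Real.exp (-(δ / (2 * ((k + 1 : ℕ) : ℝ)) / 2 * ((w : ℝ) + v + 1))) * ((L : ℝ) ^ d * (2 / (1 - Real.exp (-(δ / (2 * ((k + 1 : ℕ) : ℝ)) / 2 / Real.sqrt d))) * Real.exp (δ / (2 * ((k + 1 : ℕ) : ℝ)) / 2 / Real.sqrt d)) ^ d) *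
                    ∑ p ∈ Finset.Icc 1 s, ((admissible p D).card : ℝ) *
                    ((2 / (1 - Real.exp (-((κ / 2 - δ / 2 * ((D : ℝ) ^ 2 * Real.sqrt d)) / (p : ℕ) / Real.sqrt d))) *
                      Real.exp ((κ / 2 - δ / 2 * ((D : ℝ) ^ 2 * Real.sqrt d)) / (p : ℕ) / Real.sqrt d)) ^ d) ^ (p - 1)) *
                   (Ac * Real.exp (δ / 2 * ((D : ℝ) ^ 2 * d)) * ((L : ℝ) ^ d * (2 / (1 - Real.exp (-(δ / (2 * ((k + 1 : ℕ) : ℝ)) / Real.sqrt d))) * Real.exp (δ / (2 * ((k + 1 : ℕ) : ℝ)) / Real.sqrt d)) ^ d) *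
                    ∑ p ∈ Finset.Icc 1 s, ((admissible p D).card : ℝ) *
                    ((2 / (1 - Real.exp (-((κ / 2 - δ / 2 * ((D : ℝ) ^ 2 * Real.sqrt d)) / (p : ℕ) / Real.sqrt d))) *
                      Real.exp ((κ / 2 - δ / 2 * ((D : ℝ) ^ 2 * Real.sqrt d)) / (p : ℕ) / Real.sqrt d)) ^ d) ^ (p - 1)) ^ (k - 1)))))
                + (I.card : ℝ) * ((3 : ℝ) ^ (k + 1) *
              (2 ^ ((k + 1) * D) * 2 ^ 2 ^ ((k + 1) * D) * (max (max 1 (1 / (γA - Jc))) ((1 + V * M / (γA - Jc)) * (γ * (γ ^ j * b)))) ^ ((k + 1) * D) *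
                  Real.exp (-(δ / 2 * ((v : ℝ) + 1))) *
                (Ac * Real.exp (δ / 2 * ((D : ℝ) ^ 2 * d)) * (L : ℝ) ^ d * ∑ p ∈ Finset.Icc 1 s, ((admissible p D).card : ℝ) *
                    ((2 / (1 - Real.exp (-((κ / 2 - δ / 2 * ((D : ℝ) ^ 2 * Real.sqrt d)) / (p : ℕ) / Real.sqrt d))) *
                      Real.exp ((κ / 2 - δ / 2 * ((D : ℝ) ^ 2 * Real.sqrt d)) / (p : ℕ) / Real.sqrt d)) ^ d) ^ (p - 1)) ^ (k + 1)))) / (k + 1)!))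

            + (I.card : ℝ) * (4 * 8 ^ d * Real.exp (-((γ ^ n * b) ^ 2 / (2 * (1 / γA)))))
            ≤ (I.card : ℝ) * errTerm S ρ₁ ρ₂ ρ₃ ρ₄ Ac b t) :
    Real.exp (cumulantSum (gaussianFieldOfKernel K) (hamiltonian s D κ a J) t - (I.card : ℝ) * errTerm S ρ₁ ρ₂ ρ₃ ρ₄ Ac b t) ≤
      ∫ z, cutoffBoltzmann (hamiltonian s D κ a J) I b z ∂gaussianFieldOfKernel K := by
  classical
  -- §0 scalars
  have hL : 0 < L := by omega
  have hw' : 0 < w := hw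
  have hL1 : (1 : ℝ) ≤ (L : ℝ) := by exact_mod_cast hL
  have hγ0' : 0 ≤ γ := hγ0.le
  have hb0 : 0 < b := by
    have h1 : 0 < γ ^ (d + 1) * b := by linarith
    by_contra hb
    have hb' : b ≤ 0 := not_lt.mp hb
    nlinarith [mul_le_mul_of_nonneg_left hb' (pow_nonneg hγ0' (d + 1))]
  have hpowmono : ∀ k ≤ d + 1, γ ^ (d + 1) * b ≤ γ ^ k * b := fun k hk =>
    mul_le_mul_of_nonneg_right (pow_le_pow_of_le_one hγ0' hγ1 hk) hb0.le
  have hAc0 : 0 ≤ Ac := by rw [hAdef]; exact coefSup_nonneg s D a J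
  have hκ'0 : 0 ≤ κ / 2 - δ / 2 * ((D : ℝ) ^ 2 * Real.sqrt d) := hres.le
  -- §1 the coefficient clipped to `J` (same Hamiltonian)
  obtain ⟨a', ha'J, ha'A, -, ha'H⟩ := exists_coefSupportedIn_clip s D a J
  have ha'Ac : ∀ (p : ℕ) (Δ : Fin p → B1Eq324BenfattoLemma.Site d) (nn : Fin p → ℕ), |a' p Δ nn| ≤ Ac := by
    rw [hAdef]; exact ha'A
  -- §2 the chain data (constant diagonal displacements)
  set c : ℕ := 2 * (2 * w + v) with hc
  let τ : ℕ → B1Eq324BenfattoLemma.Site d := fun (_ : ℕ) (_ : Fin d) => -(c : ℤ)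
  let Js : ℕ → Finset (B1Eq324BenfattoLemma.Site d) := fun k => Nat.rec (motive := fun _ => Finset (B1Eq324BenfattoLemma.Site d)) J
    (fun k Jk => Jk.image (fun x => x + τ k) ∩ corridorsBar L w v ((Jk.image fun x => x + τ k).image (boxIndex L))) k
  let as : ℕ → Coef d := fun k => Nat.rec (motive := fun _ => Coef d) a'
    (fun k ak => restrictCoef (shiftCoef ak (-τ k)) (corridorsBar L w v (((Js k).image fun x => x + τ k).image (boxIndex L)))) k
  let Is : ℕ → Finset (B1Eq324BenfattoLemma.Site d) := fun k => Nat.rec (motive := fun _ => Finset (B1Eq324BenfattoLemma.Site d)) I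
    (fun k Ik => Ik.image fun x => x + τ k) k
  let bs : ℕ → ℝ := fun k => Nat.rec (motive := fun _ => ℝ) b (fun _ bk => γ * bk) k
  let σ : ℕ → B1Eq324BenfattoLemma.Site d := fun k => Nat.rec (motive := fun _ => B1Eq324BenfattoLemma.Site d) 0 (fun k σk => σk - τ k) k
  have hrecJ : ∀ k < d + 1, Js (k + 1) = (Js k).image (fun x => x + τ k) ∩
      corridorsBar L w v (((Js k).image fun x => x + τ k).image (boxIndex L)) := fun k _ => rfl
  have hbs : ∀ k, bs k = γ ^ k * b := fun k => by
    induction k with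
    | zero => simp [bs]
    | succ k ih => show γ * bs k = _; rw [ih, pow_succ]; ring
  have hbk : ∀ k ≤ d + 1, 1 ≤ bs k := fun k hk => by rw [hbs]; exact hgb1.trans (hpowmono k hk)
  have hsmk : ∀ k ≤ d, ((L : ℝ) ^ d) * Real.exp (-((bs k) ^ 2 / 4)) ≤ 1 / 6 := fun k hk => by
    refine le_trans (mul_le_mul_of_nonneg_left (Real.exp_le_exp.mpr ?_) (by positivity)) hsmall
    have h1 : γ ^ d * b ≤ bs k := by rw [hbs]; exact mul_le_mul_of_nonneg_right (pow_le_pow_of_le_one hγ0' hγ1 hk) hb0.le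
    have h0 : 0 ≤ γ ^ d * b := by positivity
    nlinarith [mul_le_mul h1 h1 h0 (h0.trans h1)]
  -- §3 the stopping index (n08-d) from the separation of the constant diagonal displacements (n08-c)
  have hsep : ∀ j j' : Fin (d + 1), j ≠ j' → ∀ (i : Fin d) (q : ℤ),
      (2 * (2 * w + v : ℕ) : ℤ) ≤ |(-(∑ i' ∈ Finset.range ((j : ℕ) + 1), τ i')) i - (-(∑ i' ∈ Finset.range ((j' : ℕ) + 1), τ i')) i - q * L| := by
    intro j j' hjj' i q
    have h := sep_of_constDiagonal (d := d) hfit j j' hjj' i q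
    push_cast at h ⊢
    exact h
  obtain ⟨m, hm, hJm, hJne⟩ := exists_stoppingIndex (L := L) (w := w) (v := v) (Js := Js)
    (Bs := fun k => ((Js k).image fun x => x + τ k).image (boxIndex L)) (τ := τ) hL hrecJ hsep
  -- the recursions along the first `m` steps
  have hrecJm : ∀ k < m, Js (k + 1) = (Js k).image (fun x => x + τ k) ∩
      corridorsBar L w v (((Js k).image fun x => x + τ k).image (boxIndex L)) := fun k _ => rfl
  have hrecIm : ∀ k < m, Is (k + 1) = (Is k).image fun x => x + τ k := fun k _ => rfl
  have hrecam : ∀ k < m, as (k + 1) = restrictCoef (shiftCoef (as k) (-τ k))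
      (corridorsBar L w v (((Js k).image fun x => x + τ k).image (boxIndex L))) := fun k _ => rfl
  have hrecbm : ∀ k < m, bs (k + 1) = γ * bs k := fun k _ => rfl
  have hσ0 : σ 0 = 0 := rfl
  have hrecσm : ∀ k < m, σ (k + 1) = σ k - τ k := fun k _ => rfl
  have hbm : ∀ k < m, 1 ≤ bs k := fun k hk => hbk k (by omega)
  have hsmm : ∀ k < m, ((L : ℝ) ^ d) * Real.exp (-(bs k ^ 2 / 4)) ≤ 1 / 6 := fun k hk => hsmk k (by omega)
  have hb0m : ∀ k < m, 0 ≤ bs k := fun k hk => zero_le_one.trans (hbm k hk)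
  -- §4 the pavements and corridors inside the frames (n08-c, from the padding)
  have hBΛ := boxes_subset_frame_of_pad (Λ := Λ) (Js := Js) (n := m)
    (Bs := fun k => ((Js k).image fun x => x + τ k).image (boxIndex L)) hL hrecJm hσ0 hrecσm hpad
  have hΓΛ := corridors_subset_frame_of_pad (Λ := Λ) (Js := Js) (n := m)
    (Bs := fun k => ((Js k).image fun x => x + τ k).image (boxIndex L)) hL hrecJm hσ0 hrecσm hpad
  -- §5 the part kernels, by definition
  let Kbs : ℕ → B1Eq324BenfattoLemma.Site d → B1Eq324BenfattoLemma.Site d → B1Eq324BenfattoLemma.Site d → ℝ := fun k mm x y =>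
    if hkm : k < m ∧ mm ∈ ((Js k).image fun x => x + τ k).image (boxIndex L) then
      if h : x ∈ shrink L mm w ∧ y ∈ shrink L mm w then
        (((A.submatrix (fun j : ↥(Λ.image fun y => y - σ (k + 1)) => (⟨(j : B1Eq324BenfattoLemma.Site d) + σ (k + 1), (mem_image_sub_iff (σ (k + 1))).mp j.2⟩ : Λ))
            (fun j : ↥(Λ.image fun y => y - σ (k + 1)) => (⟨(j : B1Eq324BenfattoLemma.Site d) + σ (k + 1), (mem_image_sub_iff (σ (k + 1))).mp j.2⟩ : Λ))).submatrix
            (fun j : ↥(shrink L mm w) => (⟨j, hBΛ k hkm.1 mm hkm.2 (shrink_subset_box L mm w j.2)⟩ : ↥(Λ.image fun y => y - σ (k + 1))))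
            (fun j : ↥(shrink L mm w) => (⟨j, hBΛ k hkm.1 mm hkm.2 (shrink_subset_box L mm w j.2)⟩ : ↥(Λ.image fun y => y - σ (k + 1)))))⁻¹ :
            Matrix ↥(shrink L mm w) ↥(shrink L mm w) ℝ) ⟨x, h.1⟩ ⟨y, h.2⟩
      else 0
    else 0
  have hKbs : ∀ k (hk : k < m) mm (hmm : mm ∈ (((Js k).image fun x => x + τ k).image (boxIndex L))) x y, Kbs k mm x y =
      if h : x ∈ shrink L mm w ∧ y ∈ shrink L mm w then
      (((A.submatrix (fun j : ↥(Λ.image fun y => y - σ (k + 1)) => (⟨(j : B1Eq324BenfattoLemma.Site d) + σ (k + 1), (mem_image_sub_iff (σ (k + 1))).mp j.2⟩ : Λ))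
          (fun j : ↥(Λ.image fun y => y - σ (k + 1)) => (⟨(j : B1Eq324BenfattoLemma.Site d) + σ (k + 1), (mem_image_sub_iff (σ (k + 1))).mp j.2⟩ : Λ))).submatrix
          (fun j : ↥(shrink L mm w) => (⟨j, hBΛ k hk mm hmm (shrink_subset_box L mm w j.2)⟩ : ↥(Λ.image fun y => y - σ (k + 1))))
          (fun j : ↥(shrink L mm w) => (⟨j, hBΛ k hk mm hmm (shrink_subset_box L mm w j.2)⟩ : ↥(Λ.image fun y => y - σ (k + 1)))))⁻¹ :
          Matrix ↥(shrink L mm w) ↥(shrink L mm w) ℝ) ⟨x, h.1⟩ ⟨y, h.2⟩ else 0 := by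
    intro k hk mm hmm x y
    exact dif_pos (And.intro hk hmm)
  -- §6 the letters at the explicit choices
  let Ku : ℕ → ℝ := fun k => (1 + V * M / (γA - Jc)) * (γ * bs k)
  let K₀ : ℕ → ℝ := fun k => max (max 1 (1 / (γA - Jc))) (Ku k)
  let ε₃₁ : ℕ → ℝ := fun k =>
    (V₂ * M₂ / (γA - Jc) ^ 2 * Real.exp (-(θ / 2 * ((w - v : ℕ) : ℝ))) + Real.exp (-(θ * ((w - v : ℕ) : ℝ))) / (γA - Jc)) +
      M₂ / (γA - Jc) * (γ * bs k) * (1 + Real.sqrt d * ((L : ℝ) - 1)) * V₄ * Real.exp (-(θ / 4 * ((w - v : ℕ) : ℝ)))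
  have hgap : 0 < γA - Jc := sub_pos.mpr hJcγ
  have hgl0 : 0 ≤ 1 + Real.sqrt d * ((L : ℝ) - 1) := by
    have : 0 ≤ Real.sqrt d * ((L : ℝ) - 1) := mul_nonneg (Real.sqrt_nonneg _) (by linarith)
    linarith
  have hKuI : ∀ k < m, (1 + V * M / (γA - Jc)) * (γ * bs k) ≤ Ku k := fun _ _ => le_rfl
  have hKuK : ∀ k < m, Ku k ≤ K₀ k := fun k _ => (K0_ties (Ku k) (1 / (γA - Jc))).2.2
  have hK₀ : ∀ k < m, 1 / (γA - Jc) ≤ K₀ k := fun k _ => (K0_ties (Ku k) (1 / (γA - Jc))).2.1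
  have hK₀1 : ∀ k < m, 1 ≤ K₀ k := fun k _ => (K0_ties (Ku k) (1 / (γA - Jc))).1
  have hε₁ : ∀ k < m, V₂ * M₂ / (γA - Jc) ^ 2 * Real.exp (-(θ / 2 * ((w - v : ℕ) : ℝ))) +
      Real.exp (-(θ * ((w - v : ℕ) : ℝ))) / (γA - Jc) ≤ ε₃₁ k := fun k hk =>
    le_add_of_nonneg_right (mul_nonneg (mul_nonneg (mul_nonneg (mul_nonneg (div_nonneg hM₂0 hgap.le)
      (mul_nonneg hγ0' (hb0m k hk))) hgl0) hV₄0) (Real.exp_pos _).le)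
  have hε₂ : ∀ k < m, M₂ / (γA - Jc) * (γ * bs k) * (1 + Real.sqrt d * ((L : ℝ) - 1)) * V₄ * Real.exp (-(θ / 4 * ((w - v : ℕ) : ℝ))) ≤
      ε₃₁ k := fun k _ =>
    le_add_of_nonneg_left (add_nonneg (by positivity) (div_nonneg (Real.exp_pos _).le hgap.le))
  -- §7 invariants and counts along the chain
  have hinv := chain_invariants (L := L) (w := w) (v := v) (n := m)
    (Bs := fun k => ((Js k).image fun x => x + τ k).image (boxIndex L)) ha'J ha'Ac hJI hrecJm hrecIm hrecam
  have hJIk : ∀ k < m, Js k ⊆ Is k := fun k hk => (hinv k hk.le).2.2.1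
  have hJcard : ∀ k < m, ((Js k).card : ℝ) ≤ (I.card : ℝ) := fun k hk => by
    exact_mod_cast (card_chain_le (Bs := fun k => ((Js k).image fun x => x + τ k).image (boxIndex L)) hrecJm k hk.le).trans
      (Finset.card_le_card hJI)
  -- §8 the knit's ledger from the pack's clause at the stopping index, through the bridge
  have hgeom := ledger_geometric_le_nI (Λ := Λ) (Js := Js) (Is := Is) (τ := τ) (σ := σ) (bs := bs) (m := m) (s := s) (D := D) (t := t)
    (E := (I.card : ℝ) * errTerm S ρ₁ ρ₂ ρ₃ ρ₄ Ac b t)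
    hκ.le hδ.le hκ'0 hAc0 hθ hJc0 hγA0 hJcγ hV0 hM0 hV₂0 hM₂0 hV₄0 hγ0' hb0m hL hL1 hw' hW1 hW2 hJne hJIk hJcard le_rfl
    (by simp only [hbs]; exact hledger m hm)
  -- §9 the class (4.7) knit at the stopping index
  have hbpos : 0 < bs m := by rw [hbs]; positivity
  have hbterm : 4 * (1 / γA) ≤ bs m ^ 2 := by rw [hbs]; exact hterm m hm
  have h13 := exp_cumulantSum_sub_le_integral_of_ledger_stop hK hΛ hAs hγA0 hγA hθ hJc hJcγ hV hM hV₂ hM₂ hV₄ hguard hκ hL2 hw' hv hγ0' hγ1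
    hAc0 (Js := Js) (Is := Is) (as := as) (bs := bs) (τ := τ) (σ := σ) (m := m) ha'J ha'Ac hJI hrecJm hrecIm hrecam hrecbm hbm hsmm
    hσ0 hrecσm hΓΛ hBΛ (Kbs := Kbs) hKbs (Ku := Ku) (K₀ := K₀) (ε₃₁ := ε₃₁) hKuI hKuK hK₀ hK₀1 hε₁ hε₂ hhalf hsmallγ hδ hδle hres t
    hI hJm hbpos hbterm hgeom
  -- §10 back to the data (`as 0 ≡ a'`, `Js 0 ≡ J`, `Is 0 ≡ I`, `bs 0 ≡ b` by `Nat.rec`; the clipped Hamiltonian is the original one)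
  have hH : hamiltonian s D κ a' J = hamiltonian s D κ a J := funext fun z => ha'H κ J (Finset.Subset.refl J) z
  rw [← hH]
  exact h13

end Member

end Literature.MathematicalPhysics.QuantumFieldTheory.Balaban1983to89.B1Eq324BenfattoKernelSect5Ineq47Class

end
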